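import Summits.QuantumFields.YangMills.Theorems.BalabanUVNodesN07DataDownTheTower
import Summits.QuantumFields.YangMills.Theorems.BalabanUVNodesN07ShearSizeTopBoxTowerGauge
import Literature.MathematicalPhysics.QuantumFieldTheory.Balaban1983to89.Node00.TorusCoverLevels
import HarnessLib

/-!
# DAG node N07 [B11] — (155) DOWN THE TOWER ON BLOW-DOWN WINDOWS: the level-`j` windows `[Lᵏ⁻ʲ·lo, Lᵏ⁻ʲ·hi + (Lᵏ⁻ʲ − 1)]` under a top box `[lo, hi]` of `T^{(k)}` ARE nested under
# blocking (integer division), so this base's `dist1_iter_le_down_the_tower` runs with the nesting DISCHARGED; and for the tower-plus-top-axial representative `U″ := U′^{h̄}`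
# (`h := axialGauge (M^k U′) lo hi`, [B11] (147)) the TOP letter is module 40's `(d−1)nδ` — print's (145)→(146)→(151) «|V″ − 1| < 9dL²Mε₀ on 𝔅_k» as a recursion whose only
# analytic inputs are the per-level plaquette smallness (7) of the representative's averages and the per-level within-block letters of the axial gauges

Cell `pub-ymgap` (HUMAN RULINGS D-0062 ∕ D-0088 ∕ D-0149), width seat `pub-ymgap-dag-n07-w6` (second wave), harness re-seat g0″, 2026-08-28; CLAIM-6 (own lineage: FILE 5 `…DataDownTheTower` + FILE 2
`…TowerGauge`).  `--kind proof --supports stmt-QuantumFields-27364 --as helper` (K1⁹ per dag-lead KEY MAP v2; count-neutral).  THEOREMS ONLY.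

THE PRINT.  [B11] = [Balaban1985Variational] pp. 300–302: (144) «□₀ ⊃ □₁ ⊃ … ⊃ □_k ⊃ □», «U′_k ∈ Ax_k(□̃(k), 1) … satisfies the generalized axial gauge conditions on □̃(k)», (145) «|U′_k(x,x′) − 1| <
|x − y|2L²ε₀ ≤ … ≤ 8dL²Mε₀», (146), (147), (151) «|V″ − 1| < 9dL²Mε₀ ≤ c₀ on 𝔅_k»; [6] = [Balaban1985RegularSpaces] Sect. F (1.131) p. 99, Lemma 1 (1.25) p. 79; [I] (0.3) p. 252 (blocks).

WHAT THIS FILE DOES (integer bookkeeping + by-name composition; NOTHING of [B11]∕[6] analysis asserted).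
* §1 BLOW-DOWN BOXES ARE NESTED UNDER BLOCKING (generic `P`): `ediv_mem_Icc_of_mem_blowDown` (`L·lo′ ≤ s ≤ L·hi′ + (L − 1) ⇒ lo′ ≤ s ∕ L ≤ hi′`, `L ≥ 1`); ★ `blockOf_mem_box_of_mem_blowDown` — for
  `x ∈ castSite '' [L·lo′, L·hi′ + (L−1)]` at level `j` (`j + 1 ≤ m + K`): `blockOf x ∈ castSite '' [lo′, hi′]` (module 38 `blockOf_coverAt`, `castSite = coverAt`); `nest_blowDown` — the
  `hnest` binder of FILE 5 for per-level boxes `lo j = L·lo (j+1)`, `hi j = L·hi (j+1) + (L − 1)` below the top.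
* §2 ★★★ `dist1_iter_le_down_the_tower_blowDown` — FILE 5's `dist1_iter_le_down_the_tower_box` with `hnest` DISCHARGED for blow-down boxes: inputs = per-level plaquette smallness of `M^j U′`
  around the `(j+1)`-bonds of the level-`(j+1)` box, per-level within-block letters `τ_j`, the top letter `v_k` on the top box, the ladder.
* §3 ★★★★ `dist1_iter_rep_le_down_the_tower_blowDown` — THE REPRESENTATIVE-KEYED CAPSTONE: for ANY `U′` and the top box `[lo k, hi k]` (`hi k ≤ lo k + n`, non-wrapping `n + 1 < N_k`), put
  `h := axialGauge (M^k U′) (lo k) (hi k)`, `U″ := U′^{h̄}` (`h̄ = blockLift k h`); if the plaquettes of `M^k U′` based in the top box are `< δ` then the TOP letter holds with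
  `v_k := (d−1)nδ` (module 40 `dist1_dataAxial_le` through this base's door `mem_boxBonds_of_ends_mem_box`, FILE 2's `iter_gaugeAct_blockLift`), so with per-level plaquette smallness of
  `M^j U″` and within-block letters for `M^j U″` the whole ladder `v_j` follows on the blow-down boxes — (151) at all levels for the representative of (147).  `plaqSmall_iter_rep_iff` — the
  per-level plaquette smallness of `M^j U″` IS that of `M^j U′` (gauge invariance, `iter_gaugeAct` + `plaqHol_gaugeAct` + `dist1_conj`), so (7) is asked of `U′`'s averages.

HONEST FRAMING (binding).  Count-neutral helper; by-name composition of LANDED theorems (this base FILE 5 p-DownTheTower ∕ FILE 2 p626639 ∕ p613291's door, dag-n07-e module 40 p606565, module 38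
`TorusCoverLevels`, lit `T4ReTrLipUnitary.plaqHol_gaugeAct`, r13 `iter_gaugeAct`); the per-level (7)-smallness, the within-block letters `τ_j` (data lane, on the axial tower of either contour
system), the ladder and the box arithmetic are HYPOTHESES ∕ the consumer's; nothing of [B11]∕[6] analysis asserted; `stub_prop8StepCoP13` ∕ K0⁷ ∕ K1⁹ NOT closed; N07 NOT discharged; the chair's
tally of record is the only count; **no summit statement is proved by this seat** — one finite `T⁴` programme at fixed `ε`, Bałaban AS PRINTED; the route closes the conditional finite-𝕋⁴ rung
`BalabanLadder.UV` only; NOT continuum ∕ ℝ⁴ ∕ OS ∕ mass gap ∕ Clay.  No `sorry`, no `def`, no `instance`, no `notation`.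
-/

noncomputable section

namespace Summit.QuantumFields.YangMills.BalabanUVNodes.N07DataDownTheTowerBlowDown

open scoped Matrix.Norms.L2Operator
open Literature.MathematicalPhysics.QuantumFieldTheory.Balaban1983to89
open Literature.MathematicalPhysics.QuantumFieldTheory.Balaban1983to89.Node00
open Literature.MathematicalPhysics.QuantumLattice (blockMap)
open T4Continuum
open T4AxialGaugeSmallField (castSite axialGauge boxPlaqs)
open B16Sect1Backgrounds (toMS iter_gaugeAct)
open B15Eq177GaugeInvariance (blockLift)
open GaugeField (gaugeAct)
open ExpMeanLog (deltaSU)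
open Summit.QuantumFields.YangMills.BalabanUVNodes.N07DataDownTheTower (dist1_iter_le_down_the_tower)
open Summit.QuantumFields.YangMills.BalabanUVNodes.N07ShearSizeTopBox (mem_boxBonds_of_ends_mem_box)
open Summit.QuantumFields.YangMills.BalabanUVNodes.N07DataAxialTopBox (dist1_dataAxial_le)
open Summit.QuantumFields.YangMills.BalabanUVNodes.N09AxialSelectionExists (iter_gaugeAct_blockLift)

/-! ## §1  Blow-down boxes are nested under blocking -/

section Boxes

variable {P : Params} {j : ℕ}

/-- Integer bookkeeping: `L·lo′ ≤ s ≤ L·hi′ + (L − 1)` with `L ≥ 1` gives `lo′ ≤ s ∕ L ≤ hi′` (floor division). [folklore] -/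
theorem ediv_mem_Icc_of_mem_blowDown {L : ℕ} (hL : 1 ≤ L) {lo' hi' s : Fin P.d → ℤ} (hs : s ∈ Set.Icc (fun i => (L : ℤ) * lo' i) (fun i => (L : ℤ) * hi' i + ((L : ℤ) - 1))) :
    (fun i => s i / (L : ℤ)) ∈ Set.Icc lo' hi' := by
  have hL0 : (0 : ℤ) < L := by exact_mod_cast hL
  refine ⟨fun i => ?_, fun i => ?_⟩
  · have h := hs.1 i
    simp only at h
    exact Int.le_ediv_of_mul_le hL0 (by rw [mul_comm]; exact h)
  · have h := hs.2 i
    simp only at h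
    have h' : s i < (hi' i + 1) * (L : ℤ) := by linarith
    exact Int.lt_add_one_iff.mp ((Int.ediv_lt_iff_lt_mul hL0).mpr h')

/-- ★ **THE BLOCK OF A SITE OF THE BLOW-DOWN BOX LIES IN THE BOX**: for `x ∈ castSite '' [L·lo′, L·hi′ + (L−1)] ⊆ T^{(j)}` (`j + 1 ≤ m + K`), `blockOf x ∈ castSite '' [lo′, hi′] ⊆ T^{(j+1)}` — module 38
`blockOf_coverAt` (`castSite = coverAt`, `blockMap L s = s ∕ L`). [cite: Balaban1987RG1, (0.3) p.252; Balaban1985RegularSpaces, (1.131) p.99] -/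
theorem blockOf_mem_box_of_mem_blowDown (hj : j + 1 ≤ P.m + P.K) {lo' hi' : Fin P.d → ℤ} {x : Site P j}
    (hx : x ∈ (castSite '' Set.Icc (fun i => (P.L : ℤ) * lo' i) (fun i => (P.L : ℤ) * hi' i + ((P.L : ℤ) - 1)) : Set (Site P j))) :
    blockOf x ∈ (castSite '' Set.Icc lo' hi' : Set (Site P (j + 1))) := by
  obtain ⟨s, hs, hsx⟩ := hx
  refine ⟨fun i => s i / (P.L : ℤ), ediv_mem_Icc_of_mem_blowDown P.L_pos hs, ?_⟩
  rw [← hsx]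
  exact (blockOf_coverAt hj s).symm

/-- **The `hnest` binder of FILE 5 for blow-down boxes**: if below the top the per-level corners satisfy `lo j = L·lo (j+1)`, `hi j = L·hi (j+1) + (L − 1)` (`j < k ≤ m + K`), then every site of the
level-`j` box has its block in the level-`(j+1)` box. [cite: Balaban1985RegularSpaces, (1.131) p.99 (bookkeeping)] -/
theorem nest_blowDown {k : ℕ} (hk : k ≤ P.m + P.K) (lo hi : ℕ → Fin P.d → ℤ)
    (hlo : ∀ j < k, lo j = fun i => (P.L : ℤ) * lo (j + 1) i) (hhi : ∀ j < k, hi j = fun i => (P.L : ℤ) * hi (j + 1) i + ((P.L : ℤ) - 1)) :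
    ∀ j < k, ∀ x : Site P j, x ∈ (castSite '' Set.Icc (lo j) (hi j) : Set (Site P j)) → blockOf x ∈ (castSite '' Set.Icc (lo (j + 1)) (hi (j + 1)) : Set (Site P (j + 1))) := by
  intro j hj x hx
  rw [hlo j hj, hhi j hj] at hx
  exact blockOf_mem_box_of_mem_blowDown (by omega) hx

end Boxes

/-! ## §2  (155) down the tower on blow-down boxes -/

section Down

variable {F : T4Continuum.T4Family} {N : ℕ} [NeZero N] {K : ℕ}

/-- ★★★ **(155) DOWN THE TOWER ON BLOW-DOWN BOXES** — FILE 5's `dist1_iter_le_down_the_tower` with the window nesting DISCHARGED: representative `U′`, height `k ≤ m + K`, per-level corners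
`lo hi : ℕ → ℤᵈ` with `lo j = L·lo (j+1)`, `hi j = L·hi (j+1) + (L−1)` below the top; per-level plaquette smallness `a_j` of `M^j U′` around the `(j+1)`-bonds of the level-`(j+1)` box
(`((d+2)L)²∕4·a_j < δ_N`), within-block letters `τ_j`, the TOP letter `v_k` on the top box and a ladder `max τ_j (v_{j+1} + 7t_j + (d+1)(L−1)τ_j) ≤ v_j` ⇒ `dist1 (M^j U′ c) ≤ v_j` on every bond of
every level-`j` box. [cite: Balaban1985Variational, (145)–(146) p.301, (151) p.301, (155) p.302; Balaban1985RegularSpaces, Lemma 1 (1.25) p.79] -/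
theorem dist1_iter_le_down_the_tower_blowDown {k : ℕ} (hk : k ≤ (F.P K).m + (F.P K).K) (U' : GaugeField (F.P K) 0 (SU N)) (lo hi : ℕ → Fin (F.P K).d → ℤ)
    (hlo : ∀ j < k, lo j = fun i => ((F.P K).L : ℤ) * lo (j + 1) i) (hhi : ∀ j < k, hi j = fun i => ((F.P K).L : ℤ) * hi (j + 1) i + (((F.P K).L : ℤ) - 1))
    (a τ v : ℕ → ℝ) (ha : ∀ j < k, 0 ≤ a j) (hτ : ∀ j < k, 0 ≤ τ j)
    (ht : ∀ j < k, (((((F.P K).d + 2) * (F.P K).L : ℕ) : ℝ) ^ 2 / 4) * a j < deltaSU (Fin N))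
    (hplaq : ∀ j < k, ∀ c : PBond (F.P K) (j + 1), c.src ∈ (castSite '' Set.Icc (lo (j + 1)) (hi (j + 1)) : Set (Site (F.P K) (j + 1))) →
      c.tgt ∈ (castSite '' Set.Icc (lo (j + 1)) (hi (j + 1)) : Set (Site (F.P K) (j + 1))) → ∀ q : Plaq (F.P K) j,
      (blockOf q.src = c.src.unshift c.dir ∨ blockOf q.src = c.src ∨ blockOf q.src = c.tgt) → dist1 (GaugeField.plaqHol (Averaging.iter (avOfRecord F N K) j U') q) < a j)
    (hint : ∀ j < k, ∀ b : PBond (F.P K) j, blockOf b.src = blockOf b.tgt →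
      blockOf b.src ∈ (castSite '' Set.Icc (lo (j + 1)) (hi (j + 1)) : Set (Site (F.P K) (j + 1))) → dist1 (Averaging.iter (avOfRecord F N K) j U' b) ≤ τ j)
    (htop : ∀ c : PBond (F.P K) k, c.src ∈ (castSite '' Set.Icc (lo k) (hi k) : Set (Site (F.P K) k)) → c.tgt ∈ (castSite '' Set.Icc (lo k) (hi k) : Set (Site (F.P K) k)) →
      dist1 (Averaging.iter (avOfRecord F N K) k U' c) ≤ v k)
    (hv : ∀ j < k, max (τ j) (v (j + 1) + 7 * ((((((F.P K).d + 2) * (F.P K).L : ℕ) : ℝ) ^ 2 / 4) * a j) + ((((F.P K).d + 1) * ((F.P K).L - 1) : ℕ) : ℝ) * τ j) ≤ v j) :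
    ∀ j ≤ k, ∀ c : PBond (F.P K) j, c.src ∈ (castSite '' Set.Icc (lo j) (hi j) : Set (Site (F.P K) j)) → c.tgt ∈ (castSite '' Set.Icc (lo j) (hi j) : Set (Site (F.P K) j)) →
      dist1 (Averaging.iter (avOfRecord F N K) j U' c) ≤ v j :=
  dist1_iter_le_down_the_tower hk U' (fun j => (castSite '' Set.Icc (lo j) (hi j) : Set (Site (F.P K) j))) (nest_blowDown hk lo hi hlo hhi) a τ v ha hτ ht hplaq hint htop hv

end Down

/-! ## §3  The representative-keyed capstone: the top letter from module 40 at the tower-plus-top-axial representative -/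

section Rep

variable {F : T4Continuum.T4Family} {N : ℕ} [NeZero N] {K : ℕ}

/-- The per-level plaquette distances of the averages are GAUGE INVARIANT: for every fine gauge `g` and level `j ≤ m + K`, `dist1 (∂(M^j(U^g))(q)) = dist1 (∂(M^j U)(q))` (r13 `iter_gaugeAct`, lit
`plaqHol_gaugeAct`, `dist1_conj`) — so the (7)-smallness asked of the representative `U″ = U′^{h̄}` IS the one of `U′`. [cite: Balaban1985Variational, (7) p.279; Balaban1985Averaging, (11) p.19] -/
theorem dist1_plaqHol_iter_gaugeAct {j : ℕ} (hj : j ≤ (F.P K).m + (F.P K).K) (g : GaugeTransf (F.P K) 0 (SU N)) (U : GaugeField (F.P K) 0 (SU N)) (q : Plaq (F.P K) j) :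
    dist1 (GaugeField.plaqHol (Averaging.iter (avOfRecord F N K) j (gaugeAct g U)) q) = dist1 (GaugeField.plaqHol (Averaging.iter (avOfRecord F N K) j U) q) := by
  rw [iter_gaugeAct (avOfRecord F N K) g U j hj, T4ReTrLipUnitary.plaqHol_gaugeAct, GaugeGroup.dist1_conj]

/-- ★★★★ **(151) AT ALL LEVELS FOR THE REPRESENTATIVE OF (147), the top letter SUPPLIED.**  Any `U′`, height `k ≤ m + K`, blow-down corners `lo hi` under a top box with `hi k ≤ lo k + n` and
non-wrapping `n + 1 < N_k`; `h := axialGauge (M^k U′) (lo k) (hi k)`, `U″ := U′^{h̄}`.  If the plaquettes of `M^k U′` based in the top box are `< δ` (`0 ≤ δ`) then the TOP letter holds for `U″`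
with `v_k := (d−1)nδ` (module 40 at FILE 2's `M^k U″ = (M^k U′)^h`), and with per-level plaquette smallness `a_j` of `M^j U″` around the level-`(j+1)` boxes, within-block letters `τ_j` for
`M^j U″` and a ladder from `v_k = (d−1)nδ`, every level-`j` box bond has `dist1 (M^j U″ c) ≤ v_j`. [cite: Balaban1985Variational, (145)–(147) p.301, (151) p.301, (155) p.302, (160) p.303] -/
theorem dist1_iter_rep_le_down_the_tower_blowDown {k : ℕ} (hk : k ≤ (F.P K).m + (F.P K).K) (U' : GaugeField (F.P K) 0 (SU N)) (lo hi : ℕ → Fin (F.P K).d → ℤ)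
    (hlo : ∀ j < k, lo j = fun i => ((F.P K).L : ℤ) * lo (j + 1) i) (hhi : ∀ j < k, hi j = fun i => ((F.P K).L : ℤ) * hi (j + 1) i + (((F.P K).L : ℤ) - 1))
    {n : ℕ} (hn : ∀ κ, hi k κ ≤ lo k κ + n) (hnN : n + 1 < (F.P K).sitesPerDir k)
    {δ : ℝ} {S₀ : Set (Plaq (F.P K) k)} (hS₀ : boxPlaqs (lo k) (hi k) ⊆ S₀) (hV : PlaqSmallOn S₀ δ (Averaging.iter (avOfRecord F N K) k U')) (hδ : 0 ≤ δ)
    (a τ v : ℕ → ℝ) (ha : ∀ j < k, 0 ≤ a j) (hτ : ∀ j < k, 0 ≤ τ j)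
    (ht : ∀ j < k, (((((F.P K).d + 2) * (F.P K).L : ℕ) : ℝ) ^ 2 / 4) * a j < deltaSU (Fin N))
    (hplaq : ∀ j < k, ∀ c : PBond (F.P K) (j + 1), c.src ∈ (castSite '' Set.Icc (lo (j + 1)) (hi (j + 1)) : Set (Site (F.P K) (j + 1))) →
      c.tgt ∈ (castSite '' Set.Icc (lo (j + 1)) (hi (j + 1)) : Set (Site (F.P K) (j + 1))) → ∀ q : Plaq (F.P K) j,
      (blockOf q.src = c.src.unshift c.dir ∨ blockOf q.src = c.src ∨ blockOf q.src = c.tgt) →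
      dist1 (GaugeField.plaqHol (Averaging.iter (avOfRecord F N K) j
        (gaugeAct (blockLift k (axialGauge (Averaging.iter (avOfRecord F N K) k U') (lo k) (hi k))) U')) q) < a j)
    (hint : ∀ j < k, ∀ b : PBond (F.P K) j, blockOf b.src = blockOf b.tgt →
      blockOf b.src ∈ (castSite '' Set.Icc (lo (j + 1)) (hi (j + 1)) : Set (Site (F.P K) (j + 1))) →
      dist1 (Averaging.iter (avOfRecord F N K) j (gaugeAct (blockLift k (axialGauge (Averaging.iter (avOfRecord F N K) k U') (lo k) (hi k))) U') b) ≤ τ j)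
    (hvk : (((F.P K).d - 1 : ℕ) : ℝ) * n * δ ≤ v k)
    (hv : ∀ j < k, max (τ j) (v (j + 1) + 7 * ((((((F.P K).d + 2) * (F.P K).L : ℕ) : ℝ) ^ 2 / 4) * a j) + ((((F.P K).d + 1) * ((F.P K).L - 1) : ℕ) : ℝ) * τ j) ≤ v j) :
    ∀ j ≤ k, ∀ c : PBond (F.P K) j, c.src ∈ (castSite '' Set.Icc (lo j) (hi j) : Set (Site (F.P K) j)) → c.tgt ∈ (castSite '' Set.Icc (lo j) (hi j) : Set (Site (F.P K) j)) →
      dist1 (Averaging.iter (avOfRecord F N K) j (gaugeAct (blockLift k (axialGauge (Averaging.iter (avOfRecord F N K) k U') (lo k) (hi k))) U') c) ≤ v j := by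
  refine dist1_iter_le_down_the_tower_blowDown hk _ lo hi hlo hhi a τ v ha hτ ht hplaq hint ?_ hv
  -- the top letter at `U″ = U′^{h̄}`: `M^k U″ = (M^k U′)^h` is module 40's re-gauged datum on the top box
  intro c hs htg
  rw [iter_gaugeAct_blockLift (avOfRecord F N K) hk _ U']
  have hN : ∀ κ, hi k κ + 1 - lo k κ < (F.P K).sitesPerDir k := fun κ => by have := hn κ; omega
  have hnN' : n < (F.P K).sitesPerDir k := by omega
  exact (dist1_dataAxial_le _ hS₀ hV hδ hn hnN' (mem_boxBonds_of_ends_mem_box hN hs htg)).trans hvk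

end Rep

end Summit.QuantumFields.YangMills.BalabanUVNodes.N07DataDownTheTowerBlowDown
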